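import Summits.AtomisticToContinuum.HydrodynamicLimit.Theorems.InformationPercolationEnginePercolationClosesChaosForecastRobustDefs
import Summits.AtomisticToContinuum.HydrodynamicLimit.Theorems.InformationPercolationEnginePercolationClosesChaosForecastRetypedProbes
import Summits.AtomisticToContinuum.HydrodynamicLimit.Theorems.InformationPercolationEnginePercolationClosesChaosForecastRobustReveal
import HarnessLib

/-!
# Red-team probes of the ROBUST re-typing of skeleton v9 (line `equilibrium-forecast-chain-rule`, crux
`InformationPercolationEngine.PercolationClosesChaos`, stmt-AtomisticToContinuum-15178) — audit certificates

Support file (`--supports stmt-AtomisticToContinuum-15178`) of the cycle-5 red-team audit (worker W6 of lead c4) of the v9 statements of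
`…ForecastRobustDefs` (`MesoStaticMaxwellRarityW`, `MesoForecastChaosB`, `CoarseLocalMaxwellianityW`, `NoKineticIrregularityB`,
`NonGoodRareW`, `BadForecastRareB`, `ForecastSplitW`, `JngSpec`, `Jng`). Nothing is asserted about the open statements; the file pins in
Lean the SEMANTIC facts the audit's verdict ("all stand as typed") rests on:

* §P1 binning conventions: `velBin`/`binCentre` are the floor bins `[βb, (β+1)b)` with centres `(β+½)b` (`velBin_eq_iff`,
  `velBin_binCentre`, `abs_binCentre_velBin_sub_le`, `binConfig_binConfig`); at a HUGE bin width a mean-zero gas is binned to the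
  octant corners `(±b/2)³`, not to one point (`velBin_eq_zero_iff`, `velBin_eq_neg_one_iff`), so `GoodUnitB` is then typically FALSE,
  not trivially true; the genuine blind spot of the binned functionals is sub-bin structure (`relEnt_binConfig_eq_zero_of_forall_velBin_eq`),
  invisible to `relEnt` itself once `b ≪ ϑs`.
* §P2 the binned guards ARE revealed and unfold as the consumers need: `goodUnitB_congr` (a function of cells and velocity bins only),
  `goodUnitB_iff`, `regularB_iff` (the bridges to `NoKineticIrregularityB` / `LocalCountUI` (ii) used by S5_W and H3_W),
  `goodUnitB_of_pop_empty_of_nbhd_empty` (void units are binned-good and weightless).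
* §P3 junk channels of `MesoStaticMaxwellRarityW` closed: the weighted summand vanishes on EMPTY cells for every floor `m₀` (also `0`),
  every `ϑh`, `b`, `T` (`msmrW_summand_eq_zero_of_pop_empty`), hence off the box (`…_of_not_mem`), and on every unit that OWNS NO
  COLLISION (`…_of_ownedCount_eq_zero`: collision-free structures weigh nothing — the design); the unit average is the finite box sum,
  lies in `[0, 27 T]` once `cℓ_N ≤ 1`, so the event is EMPTY for `27 T < δ'` (`msmrW_event_eq_empty`: the tiny-`T` corner is vacuous, not
  false); `msmrW_of_unweightedB`: the weighted statement is implied by the unweighted one read on binned velocities (registered design claim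
  `𝟙·min(ownedCount,T) ≤ T·𝟙`, kernel-checked with the quantifiers).
* §P4 the other summands are box-supported for EVERY phase point: `clmW_summand_eq_zero_of_not_mem`, `nkiB_summand_eq_zero_of_not_mem`,
  `mfcB_summand_eq_zero_of_not_mem` (binned-good far empty cells carry a zero forecast), and the REVEALED NON-GOOD INDICATOR:
  `Jng_eq_zero_of_not_mem` (registered headline `robustProbes_certificate`), `Jng_eq_zero_of_not_good` (off the good set the junk is confined
  to the cell `0`), `Jng_mul_weight_mem_Icc` (the H3_W / H5_W family takes values in `[0, T]`), `badWeight_le_min_ownedCount` (everywhere,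
  not only on the good set). The data path `histData ∘ seqHist = (obs k ·).1` is `histData_seqHist` of `…ForecastRobustReveal` (W1, landed).
-/

noncomputable section

open MeasureTheory Set Filter Topology
open scoped ENNReal BigOperators Classical
open Literature.Analysis.FluidPDE Literature.MathematicalPhysics.KineticTheory
open Literature.MathematicalPhysics.KineticTheory.VelocityBlindPlacement

namespace Summit.AtomisticToContinuum.HydrodynamicLimit.Theorems.EquilibriumForecastLine

/-! ## §P1 Binning conventions -/

/-- The bin centre, coordinatewise: `((β_m + ½) b)`. [folklore] -/
theorem binCentre_apply (b : ℝ) (β : Cell) (m : Fin 3) : binCentre b β m = (((β m : ℤ) : ℝ) + 2⁻¹) * b := rfl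

/-- **The bins are `[βb, (β+1)b)`**: `velBin b v m = β_m ↔ β_m b ≤ v_m < (β_m + 1) b` (`0 < b`). [folklore] -/
theorem velBin_eq_iff {b : ℝ} (hb : 0 < b) (v : V3) (m : Fin 3) (β : ℤ) :
    velBin b v m = β ↔ (β : ℝ) * b ≤ v m ∧ v m < ((β : ℝ) + 1) * b := by
  show ⌊v m / b⌋ = β ↔ _
  rw [Int.floor_eq_iff, le_div_iff₀ hb, div_lt_iff₀ hb]

/-- At ANY bin width the bin `0` is `[0, b)` … [folklore] -/
theorem velBin_eq_zero_iff {b : ℝ} (hb : 0 < b) (v : V3) (m : Fin 3) : velBin b v m = 0 ↔ 0 ≤ v m ∧ v m < b := by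
  rw [velBin_eq_iff hb]; simp

/-- … and the bin `-1` is `[-b, 0)`: a HUGE `b` bins a mean-zero gas to the octant corners `(±b/2)³` (eight far-apart points, binned
relative entropy `≫ 1`), NOT to a single point — `GoodUnitB` is then typically false, and large `b` is in any case never forced on a
consumer (`∃ b₀` is the prover's in all v9 statements). [folklore] -/
theorem velBin_eq_neg_one_iff {b : ℝ} (hb : 0 < b) (v : V3) (m : Fin 3) : velBin b v m = -1 ↔ -b ≤ v m ∧ v m < 0 := by
  rw [velBin_eq_iff hb]; simp

/-- Bin centres lie in their own bins: `velBin b (binCentre b β) = β` (`0 < b`). [folklore] -/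
theorem velBin_binCentre {b : ℝ} (hb : 0 < b) (β : Cell) : velBin b (binCentre b β) = β := by
  funext m
  rw [velBin_eq_iff hb, binCentre_apply]
  constructor <;> nlinarith

/-- Hence binning is idempotent: `binConfig b (binConfig b w) = binConfig b w`. [folklore] -/
theorem binConfig_binConfig {N : ℕ} {b : ℝ} (hb : 0 < b) (w : Phase N) : binConfig b (binConfig b w) = binConfig b w := by
  funext i
  simp only [binConfig, velBin_binCentre hb]

/-- **Binning moves each velocity coordinate by at most `b/2`** (so `b → 0` recovers the exact functionals continuously; no
degeneration at small `b`). [folklore] -/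
theorem abs_binCentre_velBin_sub_le {b : ℝ} (hb : 0 < b) (v : V3) (m : Fin 3) :
    |binCentre b (velBin b v) m - v m| ≤ b / 2 := by
  rw [binCentre_apply]
  have h1 : ((⌊v m / b⌋ : ℤ) : ℝ) ≤ v m / b := Int.floor_le _
  have h2 : v m / b < ((⌊v m / b⌋ : ℤ) : ℝ) + 1 := Int.lt_floor_add_one _
  rw [le_div_iff₀ hb] at h1
  rw [div_lt_iff₀ hb] at h2
  rw [abs_le]
  show -(b / 2) ≤ (((⌊v m / b⌋ : ℤ) : ℝ) + 2⁻¹) * b - v m ∧ (((⌊v m / b⌋ : ℤ) : ℝ) + 2⁻¹) * b - v m ≤ b / 2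
  constructor <;> nlinarith

/-- **The blind spot of the binned functionals is sub-bin structure**: a population whose velocities all fall in ONE bin is exactly
binned-Maxwellian (`relEnt_b = 0`) whatever the velocities do inside the bin (`ϑs ≠ 0`). Harmless for `b ≤ b₀ ≪ ϑs`: `relEnt` itself is
blind below `ϑs` (`relEnt_eq_zero_of_forall_vel_eq`). [folklore] -/
theorem relEnt_binConfig_eq_zero_of_forall_velBin_eq {N : ℕ} {ϑs : ℝ} (hϑs : ϑs ≠ 0) (b : ℝ) (w : Phase N)
    {P : Finset (Fin (N + 1))} {β : Cell} (h : ∀ i ∈ P, velBin b (w i).2 = β) : relEnt ϑs (binConfig b w) P = 0 :=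
  relEnt_eq_zero_of_forall_vel_eq hϑs (binConfig b w) (u := binCentre b β) fun i hi => by rw [binConfig_snd, h i hi]

/-! ## §P2 The binned guards are revealed and unfold as the consumers need -/

/-- **`GoodUnitB` is a function of the cells and velocity BINS of the spheres** (two configurations with the same cell labels and the
same bins have the same binned-good units) — the revealedness that the exact `GoodUnit` lacks. [folklore] -/
theorem goodUnitB_congr {N : ℕ} (b ϑs ϑ φs c σ : ℝ) {w w' : Phase N} (hc : ∀ i, cellOf c σ N (w i).1 = cellOf c σ N (w' i).1)
    (hv : ∀ i, velBin b (w i).2 = velBin b (w' i).2) (q : Cell) :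
    GoodUnitB b ϑs ϑ φs c σ N w q ↔ GoodUnitB b ϑs ϑ φs c σ N w' q :=
  goodUnit_congr ϑs ϑ φs c σ (w := binConfig b w) (w' := binConfig b w') (fun i => hc i)
    (fun i => by rw [binConfig_snd, binConfig_snd, hv i]) q

/-- `GoodUnitB` unfolded on the UNBINNED populations: `(¬Dense ∧ inhom_b(pop, nbhd) ≤ ϑ) ∧ relEnt_b(pop) ≤ ϑ` — so on an occupied
non-good unit `Dense ∨ ϑ < inhom_b ∨ ϑ < relEnt_b`, the split H3_W uses. [folklore] -/
theorem goodUnitB_iff {N : ℕ} (b ϑs ϑ φs c σ : ℝ) (w : Phase N) (q : Cell) :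
    GoodUnitB b ϑs ϑ φs c σ N w q ↔
      (¬ Dense φs c σ N w q ∧ inhom ϑs (binConfig b w) (pop c σ N w q) (nbhd c σ N w q) ≤ ϑ) ∧
        relEnt ϑs (binConfig b w) (pop c σ N w q) ≤ ϑ := by
  unfold GoodUnitB GoodUnit Regular
  rw [pop_binConfig, nbhd_binConfig, dense_binConfig_iff]

/-- `Regular` on binned velocities unfolded on the unbinned populations (the guard of `MesoStaticMaxwellRarityW` against the integrand
of `NoKineticIrregularityB`, as S5_W uses). [folklore] -/
theorem regularB_iff {N : ℕ} (b ϑs ϑh φs c σ : ℝ) (w : Phase N) (q : Cell) :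
    Regular ϑs ϑh φs c σ N (binConfig b w) q ↔
      ¬ Dense φs c σ N w q ∧ inhom ϑs (binConfig b w) (pop c σ N w q) (nbhd c σ N w q) ≤ ϑh := by
  unfold Regular
  rw [pop_binConfig, nbhd_binConfig, dense_binConfig_iff]

/-- A non-good occupied unit is packed, binned-inhomogeneous or binned-non-Maxwellian (contrapositive of `goodUnitB_iff`). [folklore] -/
theorem dense_or_inhom_or_relEnt_of_not_goodUnitB {N : ℕ} {b ϑs ϑ φs c σ : ℝ} {w : Phase N} {q : Cell}
    (h : ¬ GoodUnitB b ϑs ϑ φs c σ N w q) :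
    Dense φs c σ N w q ∨ ϑ < inhom ϑs (binConfig b w) (pop c σ N w q) (nbhd c σ N w q) ∨
      ϑ < relEnt ϑs (binConfig b w) (pop c σ N w q) := by
  rw [goodUnitB_iff] at h
  by_contra h'
  push Not at h'
  exact h ⟨⟨h'.1, h'.2.1⟩, h'.2.2⟩

/-- **Void units are binned-good** (empty cell, empty `4h`-neighbourhood; `0 < φs`, `0 < h`, `0 ≤ ϑ`) — and weightless (they own
no collision): the `J = 0` units that `ForecastSplitW` (1) files under "empty ⇒ zero forecast". [folklore] -/
theorem goodUnitB_of_pop_empty_of_nbhd_empty {N : ℕ} (b : ℝ) {ϑs ϑ φs c σ : ℝ} (hφs : 0 < φs)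
    (hh : 0 < c * meanFreePath σ N) (hϑ : 0 ≤ ϑ) {w : Phase N} {q : Cell} (hp : pop c σ N w q = ∅)
    (hn : nbhd c σ N w q = ∅) : GoodUnitB b ϑs ϑ φs c σ N w q := by
  unfold GoodUnitB
  exact goodUnit_of_pop_empty_of_nbhd_empty hφs hh hϑ (by rw [pop_binConfig, hp]) (by rw [nbhd_binConfig, hn])

/-! ## §P3 `MesoStaticMaxwellRarityW`: no junk support, bounds, the tiny-`T` corner, weaker than the unweighted statement -/

section MSMRW

variable {σ : ℝ} {N : ℕ} (Φ : Flow σ N)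

/-- **The weighted summand vanishes on every EMPTY cell**, for every floor `m₀` (`0` included), every `ϑh`, `b`, `T`: the third conjunct
asks `ϑ ≤ relEnt_b ∅ = 0`, false for `ϑ > 0`. [folklore] -/
theorem msmrW_summand_eq_zero_of_pop_empty (ϑs ϑh φs c b T : ℝ) (m₀ : ℕ) {ϑ : ℝ} (hϑ : 0 < ϑ) (k : ℕ) (z : Phase N)
    {q : Cell} (hq : pop c σ N (Φ.flow ((k : ℝ) * stepLen c σ N) z) q = ∅) :
    (if Regular ϑs ϑh φs c σ N (binConfig b (Φ.flow ((k : ℝ) * stepLen c σ N) z)) q ∧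
        m₀ ≤ (pop c σ N (Φ.flow ((k : ℝ) * stepLen c σ N) z) q).card ∧
        ϑ ≤ relEnt ϑs (binConfig b (Φ.flow ((k : ℝ) * stepLen c σ N) z))
          (pop c σ N (Φ.flow ((k : ℝ) * stepLen c σ N) z) q) then (1 : ℝ) else 0) *
      min (ownedCount c σ N Φ k q z) T = 0 := by
  rw [if_neg, zero_mul]
  rintro ⟨-, -, h3⟩
  rw [hq, relEnt_empty] at h3
  exact absurd h3 (not_le.2 hϑ)

/-- **… hence off the finite box** (`pop q = ∅` there), for EVERY phase point: the `unitAvg` of `MesoStaticMaxwellRarityW` is never a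
junk `tsum`. [folklore] -/
theorem msmrW_summand_eq_zero_of_not_mem {c : ℝ} (hh : 0 < c * meanFreePath σ N) (ϑs ϑh φs b T : ℝ) (m₀ : ℕ) {ϑ : ℝ}
    (hϑ : 0 < ϑ) (k : ℕ) (z : Phase N) {q : Cell} (hq : q ∉ cellBox (c * meanFreePath σ N)) :
    (if Regular ϑs ϑh φs c σ N (binConfig b (Φ.flow ((k : ℝ) * stepLen c σ N) z)) q ∧
        m₀ ≤ (pop c σ N (Φ.flow ((k : ℝ) * stepLen c σ N) z) q).card ∧
        ϑ ≤ relEnt ϑs (binConfig b (Φ.flow ((k : ℝ) * stepLen c σ N) z))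
          (pop c σ N (Φ.flow ((k : ℝ) * stepLen c σ N) z) q) then (1 : ℝ) else 0) *
      min (ownedCount c σ N Φ k q z) T = 0 :=
  msmrW_summand_eq_zero_of_pop_empty Φ ϑs ϑh φs c b T m₀ hϑ k z (pop_eq_empty_of_not_mem hh _ hq)

/-- **Collision-free structures weigh nothing** (the design of v9): a unit that owns no collision in the step contributes `0`, whatever
its (binned) regularity, population and relative entropy (`0 ≤ T`). [folklore] -/
theorem msmrW_summand_eq_zero_of_ownedCount_eq_zero {P : Prop} [Decidable P] {c T : ℝ} (hT : 0 ≤ T) (k : ℕ) (q : Cell)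
    (z : Phase N) (h0 : ownedCount c σ N Φ k q z = 0) :
    (if P then (1 : ℝ) else 0) * min (ownedCount c σ N Φ k q z) T = 0 := by
  rw [h0, min_eq_left hT, mul_zero]

/-- The weighted summand lies in `[0, T]` (`0 ≤ c`, `0 < σ`, `0 ≤ T`). [folklore] -/
theorem msmrW_summand_mem_Icc {P : Prop} [Decidable P] {c T : ℝ} (hc : 0 ≤ c) (hσ : 0 < σ) (hT : 0 ≤ T) (k : ℕ) (q : Cell)
    (z : Phase N) : (if P then (1 : ℝ) else 0) * min (ownedCount c σ N Φ k q z) T ∈ Set.Icc 0 T := by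
  refine ⟨weighted_nonneg (ownedCount_nonneg hc hσ Φ k q z) hT, (weighted_le_T_mul _ T).trans ?_⟩
  split_ifs <;> simp [hT]

/-- **The unit average of `MesoStaticMaxwellRarityW` IS the finite box sum**, for every phase point. [folklore] -/
theorem msmrW_unitAvg_eq_sum {c : ℝ} (hh : 0 < c * meanFreePath σ N) (ϑs ϑh φs b T : ℝ) (m₀ : ℕ) {ϑ : ℝ} (hϑ : 0 < ϑ)
    (τ : ℝ) (z : Phase N) :
    unitAvg c σ N τ (fun k q =>
        (if Regular ϑs ϑh φs c σ N (binConfig b (Φ.flow ((k : ℝ) * stepLen c σ N) z)) q ∧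
            m₀ ≤ (pop c σ N (Φ.flow ((k : ℝ) * stepLen c σ N) z) q).card ∧
            ϑ ≤ relEnt ϑs (binConfig b (Φ.flow ((k : ℝ) * stepLen c σ N) z))
              (pop c σ N (Φ.flow ((k : ℝ) * stepLen c σ N) z) q) then (1 : ℝ) else 0) *
          min (ownedCount c σ N Φ k q z) T) =
      ((numSteps c σ N τ : ℝ))⁻¹ * (c * meanFreePath σ N) ^ 3 *
        ∑ k ∈ Finset.range (numSteps c σ N τ), ∑ q ∈ cellBox (c * meanFreePath σ N),
          (if Regular ϑs ϑh φs c σ N (binConfig b (Φ.flow ((k : ℝ) * stepLen c σ N) z)) q ∧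
              m₀ ≤ (pop c σ N (Φ.flow ((k : ℝ) * stepLen c σ N) z) q).card ∧
              ϑ ≤ relEnt ϑs (binConfig b (Φ.flow ((k : ℝ) * stepLen c σ N) z))
                (pop c σ N (Φ.flow ((k : ℝ) * stepLen c σ N) z) q) then (1 : ℝ) else 0) *
            min (ownedCount c σ N Φ k q z) T :=
  unitAvg_eq_sum c σ N τ _ fun k _ hq => msmrW_summand_eq_zero_of_not_mem Φ hh ϑs ϑh φs b T m₀ hϑ k z hq

/-- **The unit average lies in `[0, 27 T]`** once `0 < cℓ_N ≤ 1` (`0 ≤ c`, `0 < σ`, `0 ≤ T`, `0 < ϑ`). [folklore] -/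
theorem msmrW_unitAvg_mem_Icc {c : ℝ} (hc : 0 ≤ c) (hσ : 0 < σ) (hh : 0 < c * meanFreePath σ N) (h1 : c * meanFreePath σ N ≤ 1)
    (ϑs ϑh φs b : ℝ) {T : ℝ} (hT : 0 ≤ T) (m₀ : ℕ) {ϑ : ℝ} (hϑ : 0 < ϑ) (τ : ℝ) (z : Phase N) :
    unitAvg c σ N τ (fun k q =>
        (if Regular ϑs ϑh φs c σ N (binConfig b (Φ.flow ((k : ℝ) * stepLen c σ N) z)) q ∧
            m₀ ≤ (pop c σ N (Φ.flow ((k : ℝ) * stepLen c σ N) z) q).card ∧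
            ϑ ≤ relEnt ϑs (binConfig b (Φ.flow ((k : ℝ) * stepLen c σ N) z))
              (pop c σ N (Φ.flow ((k : ℝ) * stepLen c σ N) z) q) then (1 : ℝ) else 0) *
          min (ownedCount c σ N Φ k q z) T) ∈ Set.Icc 0 (27 * T) :=
  ⟨unitAvg_nonneg hh.le (fun k _ hq => msmrW_summand_eq_zero_of_not_mem Φ hh ϑs ϑh φs b T m₀ hϑ k z hq)
      fun k q => (msmrW_summand_mem_Icc Φ hc hσ hT k q z).1,
    unitAvg_le_mul_of_le τ hT hh h1 (fun k _ hq => msmrW_summand_eq_zero_of_not_mem Φ hh ϑs ϑh φs b T m₀ hϑ k z hq)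
      fun k q => (msmrW_summand_mem_Icc Φ hc hσ hT k q z).2⟩

/-- **The tiny-`T` corner is VACUOUS, not false**: for `27 T < δ'` the event of `MesoStaticMaxwellRarityW` is EMPTY (its `G_N`-mass is
`0 ≤ e^{-L(N+1)}` at every rate); `T` is fixed by the consumer (`LocalCountUI` (i)) before `m₀, ϑh, c₀` are chosen. [folklore] -/
theorem msmrW_event_eq_empty {c : ℝ} (hc : 0 ≤ c) (hσ : 0 < σ) (hh : 0 < c * meanFreePath σ N) (h1 : c * meanFreePath σ N ≤ 1)
    (ϑs ϑh φs b : ℝ) {T δ' : ℝ} (hT : 0 ≤ T) (hTδ : 27 * T < δ') (m₀ : ℕ) {ϑ : ℝ} (hϑ : 0 < ϑ) (τ : ℝ) :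
    {z : Phase N | δ' < unitAvg c σ N τ (fun k q =>
        (if Regular ϑs ϑh φs c σ N (binConfig b (Φ.flow ((k : ℝ) * stepLen c σ N) z)) q ∧
            m₀ ≤ (pop c σ N (Φ.flow ((k : ℝ) * stepLen c σ N) z) q).card ∧
            ϑ ≤ relEnt ϑs (binConfig b (Φ.flow ((k : ℝ) * stepLen c σ N) z))
              (pop c σ N (Φ.flow ((k : ℝ) * stepLen c σ N) z) q) then (1 : ℝ) else 0) *
          min (ownedCount c σ N Φ k q z) T)} = ∅ := by
  refine Set.eq_empty_of_forall_notMem fun z hz => ?_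
  have h := (msmrW_unitAvg_mem_Icc Φ hc hσ hh h1 ϑs ϑh φs b hT m₀ hϑ τ z).2
  exact absurd (hTδ.trans (lt_of_lt_of_le hz h)) (lt_irrefl _)

end MSMRW

/-- **`MesoStaticMaxwellRarityW` is implied by the UNWEIGHTED statement read on binned velocities** (v5's `MesoStaticMaxwellRarity`
with `Regular`/`relEnt` on `binConfig b ·` and the layer `∃ b₀ ∀ b ≤ b₀`): pointwise `𝟙·min(ownedCount, T) ≤ T·𝟙` (`weighted_le_T_mul`),
so `{δ' < U_W} ⊆ {δ'/T < U_𝟙}`; instantiate the hypothesis at `δ'/T`. The design claim "strictly weaker", kernel-checked with all the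
quantifiers (the converse fails: collision-free rigid streams weigh `T` on the right and `0` on the left). [folklore] -/
theorem msmrW_of_unweightedB :
    (∃ φs : ℝ, 0 < φs ∧ ∃ σ₁ : ℝ, 0 < σ₁ ∧ ∀ σ : ℝ, 0 < σ → σ ≤ σ₁ → ∀ Φ : (N : ℕ) → Flow σ N, ∀ τ : ℝ, 0 < τ →
      ∀ ϑs ϑ δ' L : ℝ, 0 < ϑs → 0 < ϑ → 0 < δ' → 0 < L →
      ∃ m₀ : ℕ, ∃ ϑh : ℝ, 0 < ϑh ∧ ∃ c₀ : ℝ, 0 < c₀ ∧ ∀ c : ℝ, c₀ ≤ c → ∃ b₀ : ℝ, 0 < b₀ ∧ ∀ b : ℝ, 0 < b → b ≤ b₀ →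
      ∃ N₀ : ℕ, ∀ N : ℕ, N₀ ≤ N →
        eqLaw σ N (Φ N) {z | δ' < unitAvg c σ N τ fun k q =>
          if Regular ϑs ϑh φs c σ N (binConfig b ((Φ N).flow ((k : ℝ) * stepLen c σ N) z)) q ∧
              m₀ ≤ (pop c σ N ((Φ N).flow ((k : ℝ) * stepLen c σ N) z) q).card ∧
              ϑ ≤ relEnt ϑs (binConfig b ((Φ N).flow ((k : ℝ) * stepLen c σ N) z))
                (pop c σ N ((Φ N).flow ((k : ℝ) * stepLen c σ N) z) q) then (1 : ℝ) else 0}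
          ≤ ENNReal.ofReal (Real.exp (-(L * ((N : ℝ) + 1))))) →
    MesoStaticMaxwellRarityW := by
  rintro ⟨φs, hφs, σ₁, hσ₁, H⟩
  refine ⟨φs, hφs, σ₁, hσ₁, fun σ hσ hσ₁' Φ τ hτ ϑs ϑ δ' L T hϑs hϑ hδ' hL hT => ?_⟩
  obtain ⟨m₀, ϑh, hϑh, c₀, hc₀, Hc⟩ := H σ hσ hσ₁' Φ τ hτ ϑs ϑ (δ' / T) L hϑs hϑ (div_pos hδ' hT) hL
  refine ⟨m₀, ϑh, hϑh, c₀, hc₀, fun c hc => ?_⟩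
  obtain ⟨b₀, hb₀, Hb⟩ := Hc c hc
  refine ⟨b₀, hb₀, fun b hb hbb => ?_⟩
  obtain ⟨N₀, HN⟩ := Hb b hb hbb
  refine ⟨N₀, fun N hN => (measure_mono fun z hz => ?_).trans (HN N hN)⟩
  have hcpos : 0 < c := hc₀.trans_le hc
  have hh : 0 < c * meanFreePath σ N := mul_pos hcpos (meanFreePath_pos hσ N)
  simp only [Set.mem_setOf_eq] at hz ⊢
  rw [div_lt_iff₀ hT]
  refine hz.trans_le ?_
  have hmono := unitAvg_mono (τ := τ) hh.le
    (fun k _ hq => msmrW_summand_eq_zero_of_not_mem (Φ N) hh ϑs ϑh φs b T m₀ hϑ k z hq)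
    (G := fun k q => T * (if Regular ϑs ϑh φs c σ N (binConfig b ((Φ N).flow ((k : ℝ) * stepLen c σ N) z)) q ∧
        m₀ ≤ (pop c σ N ((Φ N).flow ((k : ℝ) * stepLen c σ N) z) q).card ∧
        ϑ ≤ relEnt ϑs (binConfig b ((Φ N).flow ((k : ℝ) * stepLen c σ N) z))
          (pop c σ N ((Φ N).flow ((k : ℝ) * stepLen c σ N) z) q) then (1 : ℝ) else 0))
    (fun k _ hq => by
      rw [if_neg, mul_zero]
      rintro ⟨-, -, h3⟩
      rw [pop_eq_empty_of_not_mem hh _ hq, relEnt_empty] at h3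
      exact absurd h3 (not_le.2 hϑ))
    (fun k q => weighted_le_T_mul _ T)
  rw [unitAvg_const_mul', mul_comm] at hmono
  exact hmono

/-! ## §P4 Box support of the other v9 summands and of the revealed non-good indicator -/

section Box

variable {σ : ℝ} {N : ℕ} (Φ : Flow σ N)

/-- **`CoarseLocalMaxwellianityW`'s summand is box-supported** (an occupied cell is in the box), for every phase point. [folklore] -/
theorem clmW_summand_eq_zero_of_not_mem {c : ℝ} (hh : 0 < c * meanFreePath σ N) (ϑs ϑ b T : ℝ) (k : ℕ) (z : Phase N)
    {q : Cell} (hq : q ∉ cellBox (c * meanFreePath σ N)) :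
    (if (pop c σ N (Φ.flow ((k : ℝ) * stepLen c σ N) z) q).Nonempty ∧
        ϑ < relEnt ϑs (binConfig b (Φ.flow ((k : ℝ) * stepLen c σ N) z))
          (pop c σ N (Φ.flow ((k : ℝ) * stepLen c σ N) z) q) then (1 : ℝ) else 0) *
      min (ownedCount c σ N Φ k q z) T = 0 := by
  rw [if_neg, zero_mul]
  rintro ⟨h1, -⟩
  rw [pop_eq_empty_of_not_mem hh _ hq] at h1
  exact Finset.not_nonempty_empty h1

/-- **`NoKineticIrregularityB`'s summand is box-supported** (an actual kinetic cell `q = cellOf x` lies in the box). [folklore] -/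
theorem nkiB_summand_eq_zero_of_not_mem {c : ℝ} (hh : 0 < c * meanFreePath σ N) (ϑs ϑ b : ℝ) (m₀ : ℕ) (k : ℕ)
    (z : Phase N) {q : Cell} (hq : q ∉ cellBox (c * meanFreePath σ N)) :
    (if (∃ x : T3, cellOf c σ N x = q) ∧ (nbhd c σ N (Φ.flow ((k : ℝ) * stepLen c σ N) z) q).Nonempty ∧
        (ϑ < inhom ϑs (binConfig b (Φ.flow ((k : ℝ) * stepLen c σ N) z))
            (pop c σ N (Φ.flow ((k : ℝ) * stepLen c σ N) z) q) (nbhd c σ N (Φ.flow ((k : ℝ) * stepLen c σ N) z) q) ∨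
          ((pop c σ N (Φ.flow ((k : ℝ) * stepLen c σ N) z) q).Nonempty ∧
            (pop c σ N (Φ.flow ((k : ℝ) * stepLen c σ N) z) q).card < m₀)) then (1 : ℝ) else 0) = 0 := by
  rw [if_neg]
  rintro ⟨⟨x, hx⟩, -⟩
  exact hq (hx ▸ cellOf_mem_cellBox hh x)

/-- **`MesoForecastChaosB` / `BadForecastRareB`'s summand is box-supported**: off the box `badWeight (k, q)` is the zero FUNCTION,
its forecast is `0`, and `δ < 0` fails (`0 ≤ δ`) — whatever the binned guard says about the far (empty, possibly binned-good) index.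
[folklore] -/
theorem mfcB_summand_eq_zero_of_not_mem {c : ℝ} (hh : 0 < c * meanFreePath σ N) (Ψ : V3 × V3 × V3 → ℝ) (η : ℝ) {T δ : ℝ}
    (hT : 0 ≤ T) (hδ : 0 ≤ δ) (b ϑs ϑ φs : ℝ) (μ : Measure (Phase N)) (k : ℕ) (z : Phase N) {q : Cell}
    (hq : q ∉ cellBox (c * meanFreePath σ N)) :
    (if GoodUnitB b ϑs ϑ φs c σ N (Φ.flow ((k : ℝ) * stepLen c σ N) z) q ∧
        δ < MeasureTheory.condExp (MeasurableSpace.comap (seqHist b c σ N Φ k q) ⊤) μ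
          (badWeight Ψ η T c σ N Φ k q) z then (1 : ℝ) else 0) = 0 := by
  have hzero : badWeight Ψ η T c σ N Φ k q = 0 := funext fun z' => badWeight_eq_zero_of_not_mem hh Ψ η hT Φ k hq z'
  rw [if_neg]
  rintro ⟨-, h2⟩
  rw [hzero, condExp_zero, Pi.zero_apply] at h2
  exact absurd h2 (not_lt.2 hδ)

/-- **`Jng` vanishes off the box for EVERY phase point** (good or not): `Jng = 1` needs a sphere OBSERVED in `q` at `kΔ`, and observed
cells lie in `cellBox (cℓ_N)` (`obs_cell_mem_cellBox`; off the good set the observation is the junk cell `0`, also in the box). So the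
weighted families `Jng · X` of H3_W / H5_W are box-supported with no appeal to `JngSpec`. [folklore] -/
theorem Jng_eq_zero_of_not_mem (b ϑs ϑ φs : ℝ) {c : ℝ} (hh : 0 < c * meanFreePath σ N) (k : ℕ) {q : Cell}
    (hq : q ∉ cellBox (c * meanFreePath σ N)) (z : Phase N) : Jng b ϑs ϑ φs c σ N Φ k q z = 0 := by
  unfold Jng
  rw [if_neg]
  rintro ⟨⟨i, hi⟩, -⟩
  rw [histData_seqHist] at hi
  simp only [popO, Finset.mem_filter, Finset.mem_univ, true_and] at hi
  exact hq (hi ▸ obs_cell_mem_cellBox Φ b c hh k z i)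

/-- **Off the good set the junk of `Jng` is confined to the cell `0`**: there every observation is `((0, 0), [])`, so `Jng (k, q) = 0`
for `q ≠ 0` (and at `q = 0` the value is an irrelevant `0/1` on a `G_N`- and `LG`-null set). [folklore] -/
theorem Jng_eq_zero_of_not_good (b ϑs ϑ φs c : ℝ) (k : ℕ) {q : Cell} (hq : q ≠ 0) {z : Phase N} (hz : z ∉ Φ.good) :
    Jng b ϑs ϑ φs c σ N Φ k q z = 0 := by
  unfold Jng
  rw [if_neg]
  rintro ⟨⟨i, hi⟩, -⟩
  rw [histData_seqHist] at hi
  simp only [popO, Finset.mem_filter, Finset.mem_univ, true_and, obs, if_neg hz] at hi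
  exact hq hi.symm

/-- **The weighted non-good family takes values in `[0, T]`** (`0 ≤ c`, `0 < σ`, `0 ≤ T`; `Jng ∈ [0, 1]`, `0 ≤ ownedCount`): bounded and
box-supported, hence its unit average is a finite sum in `[0, 27 T]` and all `unitMean`s of H3_W / H5_W (2) are honest integrals once the
weight is a.e.-measurable. [folklore] -/
theorem Jng_mul_weight_mem_Icc (b ϑs ϑ φs : ℝ) {c T : ℝ} (hc : 0 ≤ c) (hσ : 0 < σ) (hT : 0 ≤ T) (k : ℕ) (q : Cell)
    (z : Phase N) : Jng b ϑs ϑ φs c σ N Φ k q z * min (ownedCount c σ N Φ k q z) T ∈ Set.Icc 0 T := by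
  have hJ := Jng_mem_Icc b ϑs ϑ φs c σ N Φ k q z
  have hw0 : 0 ≤ min (ownedCount c σ N Φ k q z) T := le_min (ownedCount_nonneg hc hσ Φ k q z) hT
  refine ⟨mul_nonneg hJ.1 hw0, ?_⟩
  calc Jng b ϑs ϑ φs c σ N Φ k q z * min (ownedCount c σ N Φ k q z) T
      ≤ 1 * min (ownedCount c σ N Φ k q z) T := mul_le_mul_of_nonneg_right hJ.2 hw0
    _ ≤ T := by rw [one_mul]; exact min_le_right _ _

/-- On the good set `badWeight ≤ min(ownedCount, T)` — in fact everywhere (`0 ≤ c`, `0 < σ`, `0 ≤ T`): the pointwise fact behind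
`ForecastSplitW` (2), with no good-set hypothesis needed. [folklore] -/
theorem badWeight_le_min_ownedCount (Ψ : V3 × V3 × V3 → ℝ) (η : ℝ) {c T : ℝ} (hc : 0 ≤ c) (hσ : 0 < σ) (hT : 0 ≤ T) (k : ℕ)
    (q : Cell) (z : Phase N) : badWeight Ψ η T c σ N Φ k q z ≤ min (ownedCount c σ N Φ k q z) T := by
  unfold badWeight
  have hw0 : 0 ≤ min (ownedCount c σ N Φ k q z) T := le_min (ownedCount_nonneg hc hσ Φ k q z) hT
  split_ifs
  · rw [mul_one]
  · rw [mul_zero]; exact hw0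

end Box

/-- **Registered headline `robustProbes_certificate` (audit certificate of the v9 re-typing): the revealed non-good indicator `Jng` is
box-supported for EVERY phase point** — the typing fact attack (C) asked first (`Jng_eq_zero_of_not_mem` with all arguments explicit
after the colon). [folklore] -/
theorem robustProbes_certificate : ∀ (b ϑs ϑ φs c σ : ℝ) (N : ℕ) (Φ : Flow σ N) (k : ℕ) (q : Cell) (z : Phase N), 0 < c * meanFreePath σ N → q ∉ cellBox (c * meanFreePath σ N) → Jng b ϑs ϑ φs c σ N Φ k q z = 0 :=
  fun b ϑs ϑ φs _ _ _ Φ k _ z hh hq => Jng_eq_zero_of_not_mem Φ b ϑs ϑ φs hh k hq z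

end Summit.AtomisticToContinuum.HydrodynamicLimit.Theorems.EquilibriumForecastLine

end
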